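import Summits.QuantumFields.BalabanUV.Beta.EriceFlowEnclosureB12AsPrintedHistoryContagionShiftFlowZeroPrincipal
import Summits.QuantumFields.BalabanUV.Beta.EriceFlowEnclosureB12AsPrintedHistoryContagionShiftFlowZeroSemigroup
import Mathlib.Analysis.SpecialFunctions.Trigonometric.Bounds

/-!
# Beta / EriceFlowEnclosureB12AsPrintedHistoryContagionShiftFlowZeroSemigroupWitness — ASYMPTOTIC FREEDOM IS CONTAGIOUS, part 48: WITHOUT LÉVY's CRITERION THE HALF-STEP IS
# NOT DETERMINED — A NON-PRINCIPAL ABEL FUNCTION.  Parts 45–47: the Λ-coordinate is the unique (up to a constant) Abel function of the trajectories that is asymptotically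
# chart-isometric, and every such function generates THE continuous renormalization group.  Here the criterion is shown LOAD-BEARING.  From ANY strictly antitone Λ on
# ]0, e′] onto `[Λ e′, ∞[` form (def-free) **`Λ̃ = f∘Λ`, `f(y) = y + (β₀∕8)·(1 − cos(2π(y − Λ e′)∕β₀))`** — f is a strictly increasing lift of a non-trivial circle map
# commuting with the translation by β₀ (§74: `deform_strictMono`, `deform_add_nat_mul`).  THEN (§74, abstract): Λ̃ is strictly antitone and onto the same half-line, satisfies
# the SAME Abel relation along every sequence along which Λ does (`deform_abel`), generates the SAME INTEGER-TIME maps — the same trajectories, the same renormalization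
# step (`deform_rg_natCast_eq`) — but a DIFFERENT HALF-STEP: **`φ̃_{1∕2}(e′) ≠ φ_{1∕2}(e′)`** (`deform_rg_half_ne`), and `Λ̃ − Λ` is not constant (`deform_sub_not_const`: 0 at
# e′, `β₀∕4` at the half-step point).  §75, FOR THE FLOW (from ONE AF reference and part 14's package at e′): THERE IS AN ABEL FUNCTION OF THE TRAJECTORIES — strictly
# antitone, onto, with the Abel equation along EVERY box solution from every pin and even with one-loop asymptotic scaling **`g²·(Λ̃ g − Λ̃ e′) → 1`** — that is NOT the
# Λ-coordinate up to a constant, VIOLATES Lévy's criterion, and whose semigroup has the trajectories as integer times yet a half renormalization step different from the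
# canonical one (**`exists_nonprincipal_abel`**): «there exist infinitely many continuous embeddings of a homeomorphism … depending on an arbitrary function» (Zdun 2014 §1) —
# the flow-with-memory instance; first-order agreement with the chart `1∕g²` to ORDER o(1) (Lévy), not merely `g²Λ → 1`, is what selects the physical interpolation.
# Abstract in B (β-flow team, prover 1, unit `b2b-balaban-beta-bflow-p1`, gen 40; ROW AP-I·Uc × NODE U2 × ROW Λ — load-bearing witness for parts 45–47)

HONEST FRAMING (page 1 of everything the β sub-cell writes): discharging `BetaPertH` makes Bałaban's UV stability UNCONDITIONAL — a
real constructive-QFT result; it is NOT the continuum limit and NOT the Clay problem.  HONEST DEPENDENCY (cell reorg 2026-08-19,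
verbatim): «continuum YM on T⁴ ⇐ BetaPertH ∧ nine spine estimates (0/9 proved); BetaPertH ⇐ (D1) ∧ (D4) ∧ CAP+tail; G-an2-4 gates
asym, D1 and NE2/3/4.»  THIS MODULE DISCHARGES NOTHING: elementary real analysis (the cosine is 1-Lipschitz and 2π-periodic, the intermediate value theorem) over node U2's
HYPOTHESIS SHAPES on an ABSTRACT functional `B`; part 46's `rg_mem_eq`, part 45's `abel_levy_eq_dynAbel`, part 44's `tendsto_sq_mul_dynAbel`, part 35's `relativeLambda_exists`,
Mathlib's `Real.abs_cos_sub_cos_le ∕ cos_add_nat_mul_two_pi ∕ cos_pi` BY NAME — nothing restated.  PRECEDENT (classical, cited not imported): non-uniqueness of continuous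
iteration groups ∕ Abel functions «depending on an arbitrary function» — M. C. Zdun, ESAIM Proc. 46 (2014) §1; G. Szekeres, Acta Math. 100 (1958).  `ScaleShiftRate` (GAPS
G-t4-U2-1), `HistLipschitz`∕`FadingMemory` (G-t4-U2-2), [I] THEOREM 2 (p. 259, STATED WITHOUT PROOF) do not occur; NOTHING is asserted about Bałaban's actual β.
[I] = T. Bałaban, Commun. Math. Phys. **109** (1987) 249–301 [Balaban1987RG1].

WHAT THIS FILE PROVES (0 sorry, 0 def): §74 `deform_strictMono`, `deform_add_nat_mul`, `deform_base`, `deform_half`, `deform_continuous`, **`deform_abel`**, `deform_strictAntiOn`,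
`deform_onto`, **`deform_rg_natCast_eq`**, **`deform_rg_half_ne`**, `deform_sub_not_const`; §75 **`exists_nonprincipal_abel`**.  NOT CLAIMED: anything about Bałaban's β;
`BetaPertH`; continuum; Clay.
-/

namespace Summit.QuantumFields.BalabanUV.Beta.EriceFlowEnclosureB12AsPrintedHistoryContagionShiftFlowZeroSemigroupWitness

open Filter Topology Set Function Real
open Literature.MathematicalPhysics.QuantumFieldTheory.Balaban1983to89
open Literature.MathematicalPhysics.QuantumFieldTheory.Balaban1983to89.T4BetaStationary (SeqBox MemoryProfile)
open Literature.MathematicalPhysics.QuantumFieldTheory.Balaban1983to89.T4BetaFlowWellPosed (MemFlow solution)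
open Summit.QuantumFields.BalabanUV.Beta.EriceFlowEnclosureB12AsPrintedHistoryContagionShiftFlowZeroLambda (relativeLambda_exists)
open Summit.QuantumFields.BalabanUV.Beta.EriceFlowEnclosureB12AsPrintedHistoryContagionShiftFlowZeroIsometry (tendsto_sq_mul_dynAbel)
open Summit.QuantumFields.BalabanUV.Beta.EriceFlowEnclosureB12AsPrintedHistoryContagionShiftFlowZeroPrincipal (abel_levy_eq_dynAbel)
open Summit.QuantumFields.BalabanUV.Beta.EriceFlowEnclosureB12AsPrintedHistoryContagionShiftFlowZeroSemigroup (rg_mem_eq)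

noncomputable section

/-! ## §74 The deformation `f(y) = y + (β₀∕8)(1 − cos(2π(y − y₀)∕β₀))` and the deformed Abel function `f∘Λ` -/

variable {β₀ y₀ : ℝ}

/-- The deformation is STRICTLY INCREASING (β₀ > 0): the cosine is 1-Lipschitz and `(β₀∕8)·(2π∕β₀) = π∕4 < 1`. [folklore] -/
theorem deform_strictMono (hβ₀ : 0 < β₀) :
    StrictMono fun y : ℝ => y + β₀ / 8 * (1 - cos (2 * π * (y - y₀) / β₀)) := by
  intro y y' hyy'
  have hlip := abs_cos_sub_cos_le (2 * π * (y' - y₀) / β₀) (2 * π * (y - y₀) / β₀)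
  have e1 : 2 * π * (y' - y₀) / β₀ - 2 * π * (y - y₀) / β₀ = 2 * π / β₀ * (y' - y) := by field_simp; ring
  rw [e1, abs_of_pos (by positivity : 0 < 2 * π / β₀ * (y' - y))] at hlip
  have h1 := (abs_le.mp hlip).2
  show y + β₀ / 8 * (1 - cos (2 * π * (y - y₀) / β₀)) < y' + β₀ / 8 * (1 - cos (2 * π * (y' - y₀) / β₀))
  have h2 : β₀ / 8 * (2 * π / β₀ * (y' - y)) = π / 4 * (y' - y) := by field_simp; ring
  have h3 : β₀ / 8 * (cos (2 * π * (y' - y₀) / β₀) - cos (2 * π * (y - y₀) / β₀)) ≤ π / 4 * (y' - y) := by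
    rw [← h2]; exact mul_le_mul_of_nonneg_left h1 (by positivity)
  have h4 : π / 4 * (y' - y) < y' - y := by
    have hd := sub_pos.mpr hyy'
    nlinarith [pi_lt_four, pi_pos]
  linarith [h3, h4]

/-- The deformation COMMUTES WITH THE TRANSLATION by every `kβ₀` (period of the cosine). [folklore] -/
theorem deform_add_nat_mul (hβ₀ : β₀ ≠ 0) (y : ℝ) (k : ℕ) :
    (y + k * β₀) + β₀ / 8 * (1 - cos (2 * π * ((y + k * β₀) - y₀) / β₀)) = (y + β₀ / 8 * (1 - cos (2 * π * (y - y₀) / β₀))) + k * β₀ := by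
  have e1 : 2 * π * ((y + k * β₀) - y₀) / β₀ = 2 * π * (y - y₀) / β₀ + k * (2 * π) := by field_simp; ring
  rw [e1, cos_add_nat_mul_two_pi]; ring

/-- The deformation fixes the base value y₀. [folklore] -/
theorem deform_base (y₀ β₀ : ℝ) : y₀ + β₀ / 8 * (1 - cos (2 * π * (y₀ - y₀) / β₀)) = y₀ := by simp

/-- At the half period the deformation is displaced by `β₀∕4`: `f(y₀ + β₀∕2) = y₀ + β₀∕2 + β₀∕4`. [folklore] -/
theorem deform_half (hβ₀ : β₀ ≠ 0) : (y₀ + β₀ / 2) + β₀ / 8 * (1 - cos (2 * π * ((y₀ + β₀ / 2) - y₀) / β₀)) = y₀ + β₀ / 2 + β₀ / 4 := by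
  have e1 : 2 * π * ((y₀ + β₀ / 2) - y₀) / β₀ = π := by field_simp; ring
  rw [e1, cos_pi]; ring

/-- The deformation is continuous. [folklore] -/
theorem deform_continuous (y₀ β₀ : ℝ) : Continuous fun y : ℝ => y + β₀ / 8 * (1 - cos (2 * π * (y - y₀) / β₀)) := by
  fun_prop

variable {Λ : ℝ → ℝ} {e' : ℝ}

/-- **THE DEFORMED FUNCTION SATISFIES THE SAME ABEL RELATION**: if `Λ(h k) = Λ e + kβ₀` for all k, then `Λ̃(h k) = Λ̃ e + kβ₀`, `Λ̃ = f∘Λ`. [folklore] -/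
theorem deform_abel (hβ₀ : β₀ ≠ 0) {e : ℝ} {h : ℕ → ℝ} (habel : ∀ k : ℕ, Λ (h k) = Λ e + (k : ℝ) * β₀) (k : ℕ) :
    Λ (h k) + β₀ / 8 * (1 - cos (2 * π * (Λ (h k) - y₀) / β₀)) = (Λ e + β₀ / 8 * (1 - cos (2 * π * (Λ e - y₀) / β₀))) + (k : ℝ) * β₀ := by
  rw [habel k]; exact deform_add_nat_mul hβ₀ _ k

/-- The deformed function is strictly antitone on ]0, e′] when Λ is. [folklore] -/
theorem deform_strictAntiOn (hβ₀ : 0 < β₀) (hanti : StrictAntiOn Λ (Ioc 0 e')) :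
    StrictAntiOn (fun x => Λ x + β₀ / 8 * (1 - cos (2 * π * (Λ x - y₀) / β₀))) (Ioc 0 e') :=
  fun _ ha _ hb hab => deform_strictMono (y₀ := y₀) hβ₀ (hanti ha hb hab)

/-- The deformed function is onto the same half-line: `f` maps `[y₀, ∞[` onto itself (intermediate values: `f y₀ = y₀`, `f y ≥ y`), and Λ is onto `[Λ e′, ∞[ = [y₀, ∞[`.
[folklore] -/
theorem deform_onto (hβ₀ : 0 < β₀) (hy₀ : Λ e' = y₀) (honto : ∀ y : ℝ, Λ e' ≤ y → ∃ x ∈ Ioc (0 : ℝ) e', Λ x = y) (z : ℝ)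
    (hz : Λ e' + β₀ / 8 * (1 - cos (2 * π * (Λ e' - y₀) / β₀)) ≤ z) :
    ∃ x ∈ Ioc (0 : ℝ) e', Λ x + β₀ / 8 * (1 - cos (2 * π * (Λ x - y₀) / β₀)) = z := by
  have hz' : y₀ ≤ z := by
    have h := hz
    rw [hy₀, deform_base] at h
    exact h
  have hfz : z ≤ z + β₀ / 8 * (1 - cos (2 * π * (z - y₀) / β₀)) := by nlinarith [cos_le_one (2 * π * (z - y₀) / β₀)]
  have hlo : y₀ + β₀ / 8 * (1 - cos (2 * π * (y₀ - y₀) / β₀)) ≤ z := by rw [deform_base]; exact hz'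
  obtain ⟨y, hy, hyz⟩ := intermediate_value_Icc hz' (deform_continuous y₀ β₀).continuousOn ⟨hlo, hfz⟩
  obtain ⟨x, hx, hxy⟩ := honto y (by rw [hy₀]; exact hy.1)
  exact ⟨x, hx, by rw [hxy]; exact hyz⟩

/-- **SAME INTEGER TIMES**: the semigroups generated by Λ and by `Λ̃ = f∘Λ` agree at every integer time — `invFunOn Λ̃ S (Λ̃ g + kβ₀) = invFunOn Λ S (Λ g + kβ₀)` — so they have
the same trajectories and the same renormalization step. [folklore] -/
theorem deform_rg_natCast_eq (hβ₀ : 0 < β₀) (hanti : StrictAntiOn Λ (Ioc 0 e')) (honto : ∀ y : ℝ, Λ e' ≤ y → ∃ x ∈ Ioc (0 : ℝ) e', Λ x = y)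
    {g : ℝ} (hg : g ∈ Ioc (0 : ℝ) e') (k : ℕ) :
    invFunOn (fun x => Λ x + β₀ / 8 * (1 - cos (2 * π * (Λ x - y₀) / β₀))) (Ioc 0 e')
        ((Λ g + β₀ / 8 * (1 - cos (2 * π * (Λ g - y₀) / β₀))) + (k : ℝ) * β₀)
      = invFunOn Λ (Ioc 0 e') (Λ g + (k : ℝ) * β₀) := by
  obtain ⟨m₁, e₁⟩ := rg_mem_eq hanti honto hβ₀.le hg (Nat.cast_nonneg k)
  set x := invFunOn Λ (Ioc 0 e') (Λ g + (k : ℝ) * β₀) with hx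
  have hval : Λ x + β₀ / 8 * (1 - cos (2 * π * (Λ x - y₀) / β₀)) = (Λ g + β₀ / 8 * (1 - cos (2 * π * (Λ g - y₀) / β₀))) + (k : ℝ) * β₀ := by
    rw [e₁]; exact deform_add_nat_mul hβ₀.ne' _ k
  have hex : ∃ x' ∈ Ioc (0 : ℝ) e', Λ x' + β₀ / 8 * (1 - cos (2 * π * (Λ x' - y₀) / β₀))
      = (Λ g + β₀ / 8 * (1 - cos (2 * π * (Λ g - y₀) / β₀))) + (k : ℝ) * β₀ := ⟨x, m₁, hval⟩
  have m₂ := invFunOn_mem hex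
  have e₂ := invFunOn_eq hex
  exact ((deform_strictAntiOn (y₀ := y₀) hβ₀ hanti).eq_iff_eq m₂ m₁).mp (e₂.trans hval.symm) |>.symm

/-- **A DIFFERENT HALF-STEP**: at the reference pin e′ (with `y₀ = Λ e′`) the time-½ maps of Λ̃ and Λ DISAGREE — the Λ-half-step point has Λ-value `Λ e′ + β₀∕2`, where f is
displaced by `β₀∕4 ≠ 0`. [folklore] -/
theorem deform_rg_half_ne (hβ₀ : 0 < β₀) (hy₀ : Λ e' = y₀) (hanti : StrictAntiOn Λ (Ioc 0 e')) (honto : ∀ y : ℝ, Λ e' ≤ y → ∃ x ∈ Ioc (0 : ℝ) e', Λ x = y)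
    (he' : 0 < e') :
    invFunOn (fun x => Λ x + β₀ / 8 * (1 - cos (2 * π * (Λ x - y₀) / β₀))) (Ioc 0 e')
        ((Λ e' + β₀ / 8 * (1 - cos (2 * π * (Λ e' - y₀) / β₀))) + 1 / 2 * β₀)
      ≠ invFunOn Λ (Ioc 0 e') (Λ e' + 1 / 2 * β₀) := by
  have he'mem : e' ∈ Ioc (0 : ℝ) e' := ⟨he', le_rfl⟩
  obtain ⟨m₁, e₁⟩ := rg_mem_eq hanti honto hβ₀.le he'mem (by norm_num : (0 : ℝ) ≤ 1 / 2)
  set x := invFunOn Λ (Ioc 0 e') (Λ e' + 1 / 2 * β₀) with hx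
  -- the target value of the deformed half-step is `Λ e′ + β₀∕2` (f fixes y₀ = Λ e′) …
  have hbase : Λ e' + β₀ / 8 * (1 - cos (2 * π * (Λ e' - y₀) / β₀)) = Λ e' := by rw [hy₀]; exact deform_base y₀ β₀
  have hz : Λ e' + β₀ / 8 * (1 - cos (2 * π * (Λ e' - y₀) / β₀)) ≤ Λ e' + 1 / 2 * β₀ := by rw [hbase]; linarith
  obtain ⟨x', hx', hx'v⟩ := deform_onto hβ₀ hy₀ honto _ hz
  have hex : ∃ x' ∈ Ioc (0 : ℝ) e', Λ x' + β₀ / 8 * (1 - cos (2 * π * (Λ x' - y₀) / β₀))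
      = (Λ e' + β₀ / 8 * (1 - cos (2 * π * (Λ e' - y₀) / β₀))) + 1 / 2 * β₀ := ⟨x', hx', by rw [hx'v, hbase]⟩
  have e₂ := invFunOn_eq hex
  rw [hbase] at e₂
  intro hcontra
  rw [hbase] at hcontra
  rw [hcontra, e₁] at e₂
  -- … but at x the deformed value is `Λ e′ + β₀∕2 + β₀∕4`
  have hhalf : (Λ e' + 1 / 2 * β₀) + β₀ / 8 * (1 - cos (2 * π * ((Λ e' + 1 / 2 * β₀) - y₀) / β₀)) = Λ e' + 1 / 2 * β₀ + β₀ / 4 := by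
    have e : 2 * π * ((Λ e' + 1 / 2 * β₀) - y₀) / β₀ = π := by rw [hy₀]; field_simp; ring
    rw [e, cos_pi]; ring
  rw [hhalf] at e₂
  linarith

/-- `Λ̃ − Λ` is NOT constant on ]0, e′]: it vanishes at e′ and equals `β₀∕4` at the half-step point. [folklore] -/
theorem deform_sub_not_const (hβ₀ : 0 < β₀) (hy₀ : Λ e' = y₀) (hanti : StrictAntiOn Λ (Ioc 0 e')) (honto : ∀ y : ℝ, Λ e' ≤ y → ∃ x ∈ Ioc (0 : ℝ) e', Λ x = y)
    (he' : 0 < e') :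
    ¬ ∀ x ∈ Ioc (0 : ℝ) e', (Λ x + β₀ / 8 * (1 - cos (2 * π * (Λ x - y₀) / β₀))) - Λ x
        = (Λ e' + β₀ / 8 * (1 - cos (2 * π * (Λ e' - y₀) / β₀))) - Λ e' := by
  intro hconst
  have he'mem : e' ∈ Ioc (0 : ℝ) e' := ⟨he', le_rfl⟩
  obtain ⟨m₁, e₁⟩ := rg_mem_eq hanti honto hβ₀.le he'mem (by norm_num : (0 : ℝ) ≤ 1 / 2)
  have h := hconst _ m₁
  rw [e₁, hy₀, deform_base y₀ β₀] at h
  have hhalf := deform_half (y₀ := y₀) hβ₀.ne'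
  rw [show y₀ + 1 / 2 * β₀ = y₀ + β₀ / 2 by ring] at h
  linarith

/-! ## §75 For the flow with memory: a non-principal Abel function of the trajectories -/

/-- **WITHOUT LÉVY's CRITERION THE CONTINUOUS RENORMALIZATION GROUP IS NOT DETERMINED.**  `B` with memory profile `(C_m, θ)` on ]0, γ]^ℕ and the value β₀ at the zero history;
ONE AF reference t; the reference pin e′ with part 14's package; a box solution h′ from e′.  THEN there are TWO functions Λ, Λ̃ on ]0, e′] such that: Λ is part 35's
Λ-coordinate (`1∕h(n)² − 1∕h′(n)² → Λ e` along every box solution from every pin e, `Λ e′ = 0`); Λ̃ is an ABEL FUNCTION OF THE TRAJECTORIES TOO — `Λ̃(h k) = Λ̃ e + kβ₀`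
along every box solution from every pin — strictly antitone, onto `[Λ̃ e′, ∞[` with `Λ̃ e′ = 0`, even with ONE-LOOP ASYMPTOTIC SCALING `g²·Λ̃ g → 1`; the semigroups
`Λ̃⁻¹∘(Λ̃ + sβ₀)` and `Λ⁻¹∘(Λ + sβ₀)` AGREE AT ALL INTEGER TIMES (same trajectories, same renormalization step) but have DIFFERENT HALF-STEPS at e′; `Λ̃ − Λ` is not constant;
and Λ̃ VIOLATES LÉVY's CRITERION.  Lévy's o(1)-isometry — not the trajectories, not monotonicity, not `g²Λ → 1` — is what singles out the canonical interpolation of parts 46–47.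
[folklore; «infinitely many continuous embeddings … depending on an arbitrary function», Zdun 2014 §1] -/
theorem exists_nonprincipal_abel {B : (ℕ → ℝ) → ℝ} {Cm θ γ β₀ bs ta gs e' : ℝ} {t h' : ℕ → ℝ}
    (hB : MemoryProfile Cm θ γ B) (hCm : 0 ≤ Cm) (hθ0 : 0 ≤ θ) (hθ1 : θ < 1) (hbs : 0 < bs) (hta : 0 < ta)
    (h0 : ∀ u : ℕ → ℝ, SeqBox γ u → |B u - β₀| ≤ Cm * ∑' j, θ ^ j * u j)
    (hts : SeqBox γ t) (htf : MemFlow B gs t) (hprof : ∀ m : ℕ, 1 / ta ^ 2 + bs * (m : ℝ) ≤ 1 / (t m) ^ 2)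
    (he' : 0 < e') (h2e' : 2 * e' ≤ γ)
    (hs1 : 4 * Cm * e' ≤ bs * (1 - θ))
    (hs2 : e' ^ 2 * (1 / gs ^ 2 + Cm * γ / (1 - θ) ^ 2 + (2 * Cm / ((1 - θ) * bs)) ^ 2) ≤ 3 / 4)
    (hs4 : 64 * Cm * e' ^ 3 ≤ (1 - θ) ^ 2) (hs5 : Cm * (8 * e' ^ 3 + 16 * e' / bs) ≤ (1 - θ) / 4)
    (hhs' : SeqBox γ h') (hhf' : MemFlow B e' h') :
    ∃ Λ Λt : ℝ → ℝ,
      (∀ e ∈ Ioc (0 : ℝ) e', ∀ h : ℕ → ℝ, SeqBox γ h → MemFlow B e h → Tendsto (fun n => 1 / h n ^ 2 - 1 / h' n ^ 2) atTop (𝓝 (Λ e))) ∧ Λ e' = 0 ∧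
      (∀ e ∈ Ioc (0 : ℝ) e', ∀ h : ℕ → ℝ, SeqBox γ h → MemFlow B e h → ∀ k : ℕ, Λt (h k) = Λt e + (k : ℝ) * β₀) ∧
      StrictAntiOn Λt (Ioc 0 e') ∧ Λt e' = 0 ∧ (∀ y : ℝ, Λt e' ≤ y → ∃ x ∈ Ioc (0 : ℝ) e', Λt x = y) ∧
      Tendsto (fun g : ℝ => g ^ 2 * Λt g) (𝓝[>] 0) (𝓝 1) ∧
      (∀ g ∈ Ioc (0 : ℝ) e', ∀ k : ℕ, invFunOn Λt (Ioc 0 e') (Λt g + (k : ℝ) * β₀) = invFunOn Λ (Ioc 0 e') (Λ g + (k : ℝ) * β₀)) ∧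
      invFunOn Λt (Ioc 0 e') (Λt e' + 1 / 2 * β₀) ≠ invFunOn Λ (Ioc 0 e') (Λ e' + 1 / 2 * β₀) ∧
      (¬ ∀ x ∈ Ioc (0 : ℝ) e', Λt x - Λ x = Λt e' - Λ e') ∧
      ¬ (∀ W ε : ℝ, 0 < ε → ∃ δ > 0, ∀ g g' : ℝ, 0 < g → g ≤ g' → g' ≤ δ → g' ≤ e' → 1 / g ^ 2 - 1 / g' ^ 2 ≤ W →
          |(Λt g - Λt g') - (1 / g ^ 2 - 1 / g' ^ 2)| ≤ ε) := by
  have hβ₀ : 0 < β₀ :=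
    EriceFlowEnclosureB12AsPrintedHistoryContagionShiftFlowZero.valueAtZero_pos hCm hθ0 hθ1 hbs hta h0 hts htf hprof
  obtain ⟨Λ, hΛ0, hΛ, -, hanti, -, habel, hsurj⟩ :=
    relativeLambda_exists hB hCm hθ0 hθ1 hbs hta h0 hts htf hprof he' h2e' hs1 hs2 hs4 hs5 hhs' hhf'
  have honto : ∀ y : ℝ, Λ e' ≤ y → ∃ x ∈ Ioc (0 : ℝ) e', Λ x = y := by
    intro y hy
    rw [hΛ0] at hy
    obtain ⟨x, hx, -⟩ := hsurj y hy
    exact ⟨x, hx.1, hx.2⟩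
  set Λt : ℝ → ℝ := fun x => Λ x + β₀ / 8 * (1 - cos (2 * π * (Λ x - 0) / β₀)) with hΛt
  have hy₀ : Λ e' = 0 := hΛ0
  have hΛt0 : Λt e' = 0 := by
    show Λ e' + β₀ / 8 * (1 - cos (2 * π * (Λ e' - 0) / β₀)) = 0
    rw [hy₀]; exact deform_base 0 β₀
  have habelt : ∀ e ∈ Ioc (0 : ℝ) e', ∀ h : ℕ → ℝ, SeqBox γ h → MemFlow B e h → ∀ k : ℕ, Λt (h k) = Λt e + (k : ℝ) * β₀ :=
    fun e he h hhs hhf k => deform_abel (y₀ := 0) hβ₀.ne' (habel e he h hhs hhf) k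
  have hantit : StrictAntiOn Λt (Ioc 0 e') := deform_strictAntiOn (y₀ := 0) hβ₀ hanti
  have hontot : ∀ y : ℝ, Λt e' ≤ y → ∃ x ∈ Ioc (0 : ℝ) e', Λt x = y := fun y hy => deform_onto (y₀ := 0) hβ₀ hy₀ honto y hy
  have hnotconst : ¬ ∀ x ∈ Ioc (0 : ℝ) e', Λt x - Λ x = Λt e' - Λ e' := deform_sub_not_const (y₀ := 0) hβ₀ hy₀ hanti honto he'
  refine ⟨Λ, Λt, hΛ, hΛ0, habelt, hantit, hΛt0, hontot, ?_, fun g hg k => deform_rg_natCast_eq (y₀ := 0) hβ₀ hanti honto hg k,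
    deform_rg_half_ne (y₀ := 0) hβ₀ hy₀ hanti honto he', hnotconst, fun hL => hnotconst fun x hx => ?_⟩
  · -- one-loop asymptotic scaling survives the bounded deformation
    have hsc := tendsto_sq_mul_dynAbel hB hCm hθ0 hθ1 hbs hta h0 hts htf hprof hΛ he' h2e' hs1 hs2 hs4 hs5 hhs' hhf'
    rw [hΛ0] at hsc
    simp only [sub_zero] at hsc
    have hbd : Tendsto (fun g : ℝ => g ^ 2 * (β₀ / 8 * (1 - cos (2 * π * (Λ g - 0) / β₀)))) (𝓝[>] 0) (𝓝 0) := by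
      have hsq : Tendsto (fun g : ℝ => g ^ 2) (𝓝[>] (0 : ℝ)) (𝓝 0) := by
        have := ((continuous_pow 2).tendsto (0 : ℝ)).mono_left (nhdsWithin_le_nhds (s := Ioi (0 : ℝ)))
        simpa using this
      refine squeeze_zero_norm' (Eventually.of_forall fun g => ?_) (by simpa using hsq.mul_const (β₀ / 4))
      rw [norm_mul, Real.norm_eq_abs, Real.norm_eq_abs, abs_of_nonneg (sq_nonneg g)]
      refine mul_le_mul_of_nonneg_left ?_ (sq_nonneg g)
      rw [abs_le]
      constructor <;> nlinarith [cos_le_one (2 * π * (Λ g - 0) / β₀), neg_one_le_cos (2 * π * (Λ g - 0) / β₀)]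
    have := hsc.add hbd
    simp only [add_zero] at this
    exact this.congr fun g => by simp only [hΛt]; ring
  · -- Lévy's criterion would make Λ̃ − Λ constant (part 45)
    have h := abel_levy_eq_dynAbel hB hCm hθ0 hθ1 hbs hta h0 hts htf hprof hΛ he' h2e' hs1 hs2 hs4 hs5 hhs' hhf' habelt hL hx.1 hx.2
    linarith

end

end Summit.QuantumFields.BalabanUV.Beta.EriceFlowEnclosureB12AsPrintedHistoryContagionShiftFlowZeroSemigroupWitness
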